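import Summits.Ventures.HodgeRepro.Tier4.Common.AdelicDefs
import Summits.Ventures.HodgeRepro.Tier4.Line1.PlaneDefs
import Summits.Ventures.HodgeRepro.Tier4.Line1.RotationCore

/-!
# Tier4/Line1/RationalRotation — LINE L1: the rational rotation of a definite plane in typer-2's convention (t4-L1-p3)

Blind re-derivation cell `pub-hodge-repro`, Tier 4 (README §9–§10), seat t4-L1-p3.  Over typer-2's `PlaneData`
(`Tier4/Common/AdelicDefs.lean`) and the line's `IsDefinite` (`PlaneDefs.lean`), Mathlib only, no printed input:
a definite plane is anisotropic and its Gram matrix invertible (`pair_self_ne_zero_of_isDefinite`,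
`isUnit_B_of_isDefinite`); rotation parameters `c, s ≠ 0` on the conic `c²α + s²β = α` exist in characteristic `0`
(`exists_conic_params`: the parametrisation from `(1, 0)` by `l ∈ {1, 2}`); and — `exists_rational_rotation` — for
a definite plane with the ROW-hermitian relations `Ω B = −B Ωᵀ`, `P i B = B (P i)ᵀ` (the convention of typer-2's
`unitaryGroup`, STATUS.md S12500) there is `γ ∈ GL₄(k)` with `γ Ω = Ω γ`, `γ B γᵀ = B`, which moves every non-zero vector
of either `P`-line to a vector with both `P`-components non-zero: `γ = B r B⁻¹` with `r` the rotation of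
`RotationCore.exists_rotation` for the transposed data `(B, Ωᵀ, (P i)ᵀ)`.

Nothing here says anything about the status of the Hodge conjecture for CM abelian varieties, which is NOT proved
(HC_CM is NOT proved by anyone in this repository).
-/

set_option autoImplicit false

noncomputable section

namespace Summit.Ventures.HodgeRepro.Tier4.Line1

open NumberField Summit.Ventures.HodgeRepro.Tier4.Common Matrix

variable {k : Type} [Field k] [NumberField k] (W : PlaneData k)


omit [NumberField k] in
/-- a definite plane is anisotropic: `β(v, v) ≠ 0` for `v ≠ 0`. -/
theorem pair_self_ne_zero_of_isDefinite (hW : IsDefinite W) {v : Fin 4 → k} (hv : v ≠ 0) :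
    v ⬝ᵥ (W.B *ᵥ v) ≠ 0 := by
  obtain ⟨σ, hσ⟩ := hW
  have hvσ : (σ ∘ v) ≠ 0 := by
    intro h
    apply hv
    funext i
    have := congrFun h i
    simp only [Function.comp_apply, Pi.zero_apply] at this
    exact (map_eq_zero σ).mp this
  have hmap : σ (v ⬝ᵥ (W.B *ᵥ v)) = (σ ∘ v) ⬝ᵥ ((W.B.map σ) *ᵥ (σ ∘ v)) := by
    rw [RingHom.map_dotProduct]
    congr 1
    funext i
    exact RingHom.map_mulVec σ W.B v i
  intro h0
  rw [h0, map_zero] at hmap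
  rcases hσ with hpos | hneg
  · have := hpos.dotProduct_mulVec_pos hvσ
    simp only [star_trivial] at this
    rw [← hmap] at this
    exact lt_irrefl _ this
  · have := hneg.dotProduct_mulVec_pos hvσ
    simp only [star_trivial, neg_mulVec, dotProduct_neg] at this
    rw [← hmap, neg_zero] at this
    exact lt_irrefl _ this

omit [NumberField k] in
/-- the Gram matrix of a definite plane is invertible. -/
theorem isUnit_B_of_isDefinite (hW : IsDefinite W) : IsUnit W.B := by
  obtain ⟨σ, hσ⟩ := hW
  have hunit : IsUnit (W.B.map σ) := by
    rcases hσ with hpos | hneg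
    · exact hpos.isUnit
    · have := hneg.isUnit.neg
      rwa [neg_neg] at this
  rw [Matrix.isUnit_iff_isUnit_det] at hunit ⊢
  rw [← RingHom.mapMatrix_apply, ← RingHom.map_det] at hunit
  rw [isUnit_iff_ne_zero] at hunit ⊢
  intro h
  apply hunit
  rw [h, map_zero]

omit [NumberField k] in
/-- the conic identity behind the rotation parameters. -/
theorem conic_identity {m l α : k} (hden : 1 + m * (l * l) ≠ 0) :
    ((1 - m * (l * l)) / (1 + m * (l * l))) * ((1 - m * (l * l)) / (1 + m * (l * l))) * α
      + (2 * l / (1 + m * (l * l))) * (2 * l / (1 + m * (l * l))) * (m * α) = α := by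
  rw [div_mul_div_comm, div_mul_div_comm, div_mul_eq_mul_div, div_mul_eq_mul_div, ← add_div,
    div_eq_iff (mul_ne_zero hden hden)]
  ring

/-- rotation parameters on the conic `c²α + s²β = α` with `c s ≠ 0` exist over a field of characteristic `0`. -/
theorem exists_conic_params {α β : k} (hα : α ≠ 0) :
    ∃ c s : k, c ≠ 0 ∧ s ≠ 0 ∧ c * c * α + s * s * β = α := by
  obtain ⟨m, hβm⟩ : ∃ m : k, β = m * α := ⟨β / α, by rw [div_mul_cancel₀ _ hα]⟩
  -- a parameter `l ≠ 0` with `m l² ∉ {1, -1}`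
  have hl : ∃ l : k, l ≠ 0 ∧ m * (l * l) ≠ 1 ∧ m * (l * l) ≠ -1 := by
    by_cases h1 : m * (1 * 1) = 1 ∨ m * (1 * 1) = -1
    · refine ⟨2, two_ne_zero, ?_, ?_⟩
      · intro h2
        rcases h1 with h1 | h1
        · have h' : (3 : k) = 0 := by linear_combination h2 - 4 * h1
          exact absurd h' (by norm_num)
        · have h' : (5 : k) = 0 := by linear_combination 4 * h1 - h2
          exact absurd h' (by norm_num)
      · intro h2
        rcases h1 with h1 | h1
        · have h' : (5 : k) = 0 := by linear_combination h2 - 4 * h1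
          exact absurd h' (by norm_num)
        · have h' : (3 : k) = 0 := by linear_combination 4 * h1 - h2
          exact absurd h' (by norm_num)
    · simp only [not_or] at h1
      exact ⟨1, one_ne_zero, h1.1, h1.2⟩
  obtain ⟨l, hl0, hl1, hl2⟩ := hl
  have hden : 1 + m * (l * l) ≠ 0 := by
    intro h
    apply hl2
    linear_combination h
  refine ⟨(1 - m * (l * l)) / (1 + m * (l * l)), 2 * l / (1 + m * (l * l)), ?_, ?_, ?_⟩
  · refine div_ne_zero ?_ hden
    intro h
    apply hl1
    linear_combination -h
  · exact div_ne_zero (mul_ne_zero two_ne_zero hl0) hden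
  · rw [hβm]
    exact conic_identity hden

omit [NumberField k] in
/-- orthogonality of the two `P`-lines in the transposed (column) picture: if `(P 0)ᵀ u = u` and
`(P 1)ᵀ w = w` then `β(u, w) = 0` (row self-adjointness `P B = B Pᵀ`). -/
theorem pair_eq_zero_of_lines (hPB : ∀ i, W.P i * W.B = W.B * (W.P i)ᵀ) {u w : Fin 4 → k}
    (hu : (W.P 0)ᵀ *ᵥ u = u) (hw : (W.P 1)ᵀ *ᵥ w = w) : u ⬝ᵥ (W.B *ᵥ w) = 0 := by
  have h10 : W.P 1 * W.P 0 = 0 := by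
    have h := W.P_sum
    have : W.P 1 = 1 - W.P 0 := by rw [← h]; abel
    rw [this, sub_mul, one_mul, W.P_idem 0, sub_self]
  calc u ⬝ᵥ (W.B *ᵥ w) = ((W.P 0)ᵀ *ᵥ u) ⬝ᵥ (W.B *ᵥ ((W.P 1)ᵀ *ᵥ w)) := by rw [hu, hw]
    _ = u ⬝ᵥ ((W.P 0 * W.B * (W.P 1)ᵀ) *ᵥ w) := by
        rw [mulVec_transpose, ← dotProduct_mulVec]
        simp only [mulVec_mulVec, Matrix.mul_assoc]
    _ = 0 := by
        rw [hPB 0, Matrix.mul_assoc, ← Matrix.transpose_mul, h10, Matrix.transpose_zero, Matrix.mul_zero,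
          zero_mulVec, dotProduct_zero]

/-- **the rational rotation of the plane, in typer-2's convention**: for a definite plane with the row-hermitian
relations there is `γ ∈ GL₄(k)` commuting with `Ω`, with `γ B γᵀ = B`, which moves every non-zero vector of either
`P`-line to a vector with both `P`-components non-zero. -/
theorem exists_rational_rotation (hW : IsDefinite W) {d : k}
    (hΩ : W.Ω * W.Ω = -(d • (1 : Matrix (Fin 4) (Fin 4) k))) (hd : ¬ IsSquare (-d))
    (hrow : W.Ω * W.B = -(W.B * W.Ωᵀ)) (hPB : ∀ i, W.P i * W.B = W.B * (W.P i)ᵀ)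
    (hPr : ∀ i, (W.P i).rank = 2) :
    ∃ γ : Matrix (Fin 4) (Fin 4) k, γ * W.Ω = W.Ω * γ ∧ γ * W.B * γᵀ = W.B ∧ IsUnit γ ∧
      ∀ i : Fin 2, ∀ q ∈ LinearMap.range (W.P i).mulVecLin, q ≠ 0 →
        W.P 0 *ᵥ (γ *ᵥ q) ≠ 0 ∧ W.P 1 *ᵥ (γ *ᵥ q) ≠ 0 := by
  -- the transposed (column) picture
  set Om : Matrix (Fin 4) (Fin 4) k := W.Ωᵀ with hOmdef
  have hOm : Om * Om = -(d • (1 : Matrix (Fin 4) (Fin 4) k)) := by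
    rw [hOmdef, ← Matrix.transpose_mul, hΩ, Matrix.transpose_neg, Matrix.transpose_smul,
      Matrix.transpose_one]
  have hherm : Omᵀ * W.B = -(W.B * Om) := by
    rw [hOmdef, Matrix.transpose_transpose]
    exact hrow
  have hpOm : ∀ i, (W.P i)ᵀ * Om = Om * (W.P i)ᵀ := by
    intro i
    rw [hOmdef, ← Matrix.transpose_mul, ← Matrix.transpose_mul, W.P_comm i]
  have hpidem : ∀ i, (W.P i)ᵀ * (W.P i)ᵀ = (W.P i)ᵀ := by
    intro i
    rw [← Matrix.transpose_mul, W.P_idem i]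
  have h10 : W.P 1 * W.P 0 = 0 := by
    have h := W.P_sum
    have : W.P 1 = 1 - W.P 0 := by rw [← h]; abel
    rw [this, sub_mul, one_mul, W.P_idem 0, sub_self]
  have h01 : W.P 0 * W.P 1 = 0 := by
    have h := W.P_sum
    have : W.P 0 = 1 - W.P 1 := by rw [← h]; abel
    rw [this, sub_mul, one_mul, W.P_idem 1, sub_self]
  -- non-zero vectors of the transposed lines
  have hrank : ∀ i, Module.finrank k (LinearMap.range ((W.P i)ᵀ).mulVecLin) = 2 := by
    intro i
    have := hPr i
    rw [← Matrix.rank_transpose] at this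
    exact this
  have hne : ∀ i, LinearMap.range ((W.P i)ᵀ).mulVecLin ≠ ⊥ := by
    intro i h
    have h2 := hrank i
    rw [h, finrank_bot] at h2
    exact absurd h2 (by norm_num)
  obtain ⟨x, hxmem, hx⟩ := Submodule.exists_mem_ne_zero_of_ne_bot (hne 0)
  obtain ⟨y, hymem, hy⟩ := Submodule.exists_mem_ne_zero_of_ne_bot (hne 1)
  have hfix : ∀ i, ∀ v ∈ LinearMap.range ((W.P i)ᵀ).mulVecLin, (W.P i)ᵀ *ᵥ v = v := by
    intro i v hv
    obtain ⟨w, hw⟩ := hv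
    simp only [mulVecLin_apply] at hw
    rw [← hw, mulVec_mulVec, hpidem i]
  have hx0 : (W.P 0)ᵀ *ᵥ x = x := hfix 0 x hxmem
  have hy1 : (W.P 1)ᵀ *ᵥ y = y := hfix 1 y hymem
  have hy0 : (W.P 0)ᵀ *ᵥ y = 0 := by
    rw [← hy1, mulVec_mulVec, ← Matrix.transpose_mul, h10, Matrix.transpose_zero, zero_mulVec]
  have hOy1 : (W.P 1)ᵀ *ᵥ (Om *ᵥ y) = Om *ᵥ y := by
    rw [mulVec_mulVec, hpOm 1, ← mulVec_mulVec, hy1]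
  have hxy : x ⬝ᵥ (W.B *ᵥ y) = 0 := pair_eq_zero_of_lines W hPB hx0 hy1
  have hxOy : x ⬝ᵥ (W.B *ᵥ (Om *ᵥ y)) = 0 := pair_eq_zero_of_lines W hPB hx0 hOy1
  have hα : x ⬝ᵥ (W.B *ᵥ x) ≠ 0 := pair_self_ne_zero_of_isDefinite W hW hx
  have hβ : y ⬝ᵥ (W.B *ᵥ y) ≠ 0 := pair_self_ne_zero_of_isDefinite W hW hy
  -- the parameters and the rotation
  obtain ⟨c, s, hc0, hs0, hc⟩ := exists_conic_params (β := y ⬝ᵥ (W.B *ᵥ y)) hα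
  have hs' : (s * (y ⬝ᵥ (W.B *ᵥ y)) / (x ⬝ᵥ (W.B *ᵥ x))) * (x ⬝ᵥ (W.B *ᵥ x)) = s * (y ⬝ᵥ (W.B *ᵥ y)) :=
    div_mul_cancel₀ _ hα
  obtain ⟨r, hrOm, hrB, hru, hrx, hry⟩ := Rot.exists_rotation (B := W.B) (Om := Om) (p₀ := (W.P 0)ᵀ)
    W.B_symm hherm hOm hd (hpOm 0) hx hy hx0 hy0 hxy hxOy hα hc hs'
  set s' : k := s * (y ⬝ᵥ (W.B *ᵥ y)) / (x ⬝ᵥ (W.B *ᵥ x)) with hs'def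
  have hs'0 : s' ≠ 0 := div_ne_zero (mul_ne_zero hs0 hβ) hα
  -- `B` is invertible
  have hBu : IsUnit W.B := isUnit_B_of_isDefinite W hW
  have hBdet : IsUnit W.B.det := (Matrix.isUnit_iff_isUnit_det W.B).mp hBu
  have hBB : W.B * W.B⁻¹ = 1 := Matrix.mul_nonsing_inv W.B hBdet
  have hBB' : W.B⁻¹ * W.B = 1 := Matrix.nonsing_inv_mul W.B hBdet
  have hrdet : IsUnit r.det := (Matrix.isUnit_iff_isUnit_det r).mp hru
  have hrr : r * r⁻¹ = 1 := Matrix.mul_nonsing_inv r hrdet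
  have hrr' : r⁻¹ * r = 1 := Matrix.nonsing_inv_mul r hrdet
  refine ⟨W.B * r * W.B⁻¹, ?_, ?_, ?_, ?_⟩
  · -- commutation with `Ω`: `Ω = B (-Om) B⁻¹`
    have hΩ' : W.Ω = W.B * (-Om) * W.B⁻¹ := by
      have : W.Ω * W.B = W.B * (-Om) := by rw [hrow, Matrix.mul_neg]
      calc W.Ω = W.Ω * W.B * W.B⁻¹ := by rw [Matrix.mul_assoc, hBB, Matrix.mul_one]
        _ = W.B * (-Om) * W.B⁻¹ := by rw [this]
    rw [hΩ']
    have hcan : ∀ X : Matrix (Fin 4) (Fin 4) k, W.B⁻¹ * (W.B * X) = X := fun X => by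
      rw [← Matrix.mul_assoc, hBB', Matrix.one_mul]
    simp only [Matrix.mul_assoc, hcan]
    rw [← Matrix.mul_assoc r (-Om), Matrix.mul_neg, hrOm, ← Matrix.neg_mul, Matrix.mul_assoc]
  · -- isometry: `r B⁻¹ rᵀ = B⁻¹` from `rᵀ B r = B`
    have hrT : IsUnit rᵀ.det := by rw [Matrix.det_transpose]; exact hrdet
    have hrTr : rᵀ⁻¹ * rᵀ = 1 := Matrix.nonsing_inv_mul rᵀ hrT
    have hinv : W.B⁻¹ = r⁻¹ * W.B⁻¹ * rᵀ⁻¹ := by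
      conv_lhs => rw [← hrB]
      rw [Matrix.mul_inv_rev, Matrix.mul_inv_rev, Matrix.mul_assoc]
    have hrBr : r * W.B⁻¹ * rᵀ = W.B⁻¹ := by
      calc r * W.B⁻¹ * rᵀ = r * (r⁻¹ * W.B⁻¹ * rᵀ⁻¹) * rᵀ := by rw [← hinv]
        _ = (r * r⁻¹) * W.B⁻¹ * (rᵀ⁻¹ * rᵀ) := by simp only [Matrix.mul_assoc]
        _ = W.B⁻¹ := by rw [hrr, hrTr, Matrix.one_mul, Matrix.mul_one]
    have hBT : W.B⁻¹ᵀ = W.B⁻¹ := by rw [Matrix.transpose_nonsing_inv, W.B_symm]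
    rw [Matrix.transpose_mul, Matrix.transpose_mul, hBT, W.B_symm]
    calc W.B * r * W.B⁻¹ * W.B * (W.B⁻¹ * (rᵀ * W.B))
        = W.B * (r * (W.B⁻¹ * W.B) * W.B⁻¹ * rᵀ) * W.B := by simp only [Matrix.mul_assoc]
      _ = W.B * (r * W.B⁻¹ * rᵀ) * W.B := by rw [hBB', Matrix.mul_one]
      _ = W.B := by rw [hrBr, hBB, Matrix.one_mul]
  · exact (hBu.mul hru).mul (Matrix.isUnit_nonsing_inv_iff.mpr hBu)
  · -- general position
    intro i q hq hq0
    -- `B⁻¹ q` lies in the transposed line `i`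
    have hq' : W.B⁻¹ *ᵥ q ∈ LinearMap.range ((W.P i)ᵀ).mulVecLin := by
      obtain ⟨w, hw⟩ := hq
      simp only [mulVecLin_apply] at hw
      refine ⟨W.B⁻¹ *ᵥ w, ?_⟩
      simp only [mulVecLin_apply]
      rw [← hw, mulVec_mulVec, mulVec_mulVec]
      congr 1
      -- `(P i)ᵀ B⁻¹ = B⁻¹ (P i)`
      calc (W.P i)ᵀ * W.B⁻¹ = W.B⁻¹ * (W.B * (W.P i)ᵀ) * W.B⁻¹ := by
            rw [← Matrix.mul_assoc, hBB', Matrix.one_mul]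
        _ = W.B⁻¹ * (W.P i * W.B) * W.B⁻¹ := by rw [hPB i]
        _ = W.B⁻¹ * W.P i := by rw [Matrix.mul_assoc, Matrix.mul_assoc, hBB, Matrix.mul_one]
    have hq'0 : W.B⁻¹ *ᵥ q ≠ 0 := by
      intro h
      apply hq0
      have := congrArg (fun v => W.B *ᵥ v) h
      simpa [mulVec_mulVec, hBB] using this
    -- `r` moves it to general position in the transposed picture
    have hgen : (W.P 0)ᵀ *ᵥ (r *ᵥ (W.B⁻¹ *ᵥ q)) ≠ 0 ∧ (W.P 1)ᵀ *ᵥ (r *ᵥ (W.B⁻¹ *ᵥ q)) ≠ 0 := by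
      have hp01 : (W.P 0)ᵀ * (W.P 1)ᵀ = 0 := by
        rw [← Matrix.transpose_mul, h10, Matrix.transpose_zero]
      have hp10 : (W.P 1)ᵀ * (W.P 0)ᵀ = 0 := by
        rw [← Matrix.transpose_mul, h01, Matrix.transpose_zero]
      have hr0 : ((W.P 0)ᵀ).rank = 2 := by rw [Matrix.rank_transpose]; exact hPr 0
      have hr1 : ((W.P 1)ᵀ).rank = 2 := by rw [Matrix.rank_transpose]; exact hPr 1
      refine Rot.general_position hOm hd (hpOm 0) (hpOm 1) hp01 hp10 hr0 hr1 hx hy hx0 hy1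
        (hfix 0) (hfix 1) hrOm hc0 hs0 hs'0 hrx hry ?_ hq'0
      fin_cases i
      · exact Or.inl hq'
      · exact Or.inr hq'
    -- transport through `B`
    have hB0 : ∀ v : Fin 4 → k, W.B *ᵥ v = 0 → v = 0 := by
      intro v hv
      have := congrArg (fun u => W.B⁻¹ *ᵥ u) hv
      simpa [mulVec_mulVec, hBB'] using this
    have key : ∀ j : Fin 2, W.P j *ᵥ ((W.B * r * W.B⁻¹) *ᵥ q) =
        W.B *ᵥ ((W.P j)ᵀ *ᵥ (r *ᵥ (W.B⁻¹ *ᵥ q))) := by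
      intro j
      simp only [mulVec_mulVec]
      congr 1
      calc W.P j * (W.B * r * W.B⁻¹) = (W.P j * W.B) * r * W.B⁻¹ := by simp only [Matrix.mul_assoc]
        _ = W.B * (W.P j)ᵀ * r * W.B⁻¹ := by rw [hPB j]
        _ = W.B * ((W.P j)ᵀ * (r * W.B⁻¹)) := by simp only [Matrix.mul_assoc]
    refine ⟨?_, ?_⟩
    · rw [key 0]
      exact fun h => hgen.1 (hB0 _ h)
    · rw [key 1]
      exact fun h => hgen.2 (hB0 _ h)


end Summit.Ventures.HodgeRepro.Tier4.Line1
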